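import Mathlib
import Summits.MatrixMultiplication.MatrixMultiplication.Theorems.SnSubsetDichotomyPolynomialSlackHeavyQuotients

/-!
# Two heavy quotients: `heavyQuotients` with common bounds on the spread products and the logarithms

Crux `Summit.MatrixMultiplication.MatrixMultiplication.Theses.SnSubsetDichotomy.PolynomialSlack`
(item `stmt-MatrixMultiplication-8306`), level-one programme, lead c5, line transport-split-hull.
`heavyQuotients` bounds `2N - n! - n!√(n!)/√(n(n-1)/6)` for a parity-pure TPP triple `S, T, U ⊆ S_n`
(`n ≥ 40`, `N = |S||T||U|`, spread parameters `λ_A, λ_B, λ_C ≥ 1` of the three pair marginals) by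
`2(n-1)·N·(x_A x_B d_C + x_A d_B x_C + d_A x_B x_C)` with
`x_X = √(100(1+log n)·λ_X·log(4n·n!/|X|)/n)` and `d_X = √(100·((1+log n)·log(4n·n!/|X|))/n)`.
This file records the bookkeeping consequence used at the entry of the point/spread dichotomy: if the
three pairwise products `λ_Aλ_B, λ_Bλ_C, λ_Cλ_A` are at most `Λ` and the three logarithmic factors
`(1+log n)·log(4n·n!/|X|)` are at most `L ≥ 0`, then each cyclic term is at most `1000·√Λ·(L√L)/(n√n)`
(compare the squares: `10⁶·λλ'·L³/n³ ≤ 10⁶·Λ·L³/n³`), whence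

* `twoHeavyQuotients` — `2N - n! - n!√(n!)/√(n(n-1)/6) ≤ 6000·(n-1)·N·√Λ·(L√L)/(n√n)`.
-/

namespace Summit.MatrixMultiplication.MatrixMultiplication.Theorems.PolynomialSlack

open scoped BigOperators
open Literature.Combinatorics.Additive (TripleProductProperty)

-- `Summit.<Summit>.<Problem>` is the tree's mandated summit-side namespace (CONVENTIONS §2); for
-- this single-conjunct summit the two coincide, so each declaration silences `dupNamespace`.
set_option linter.dupNamespace false

/-- Monotonicity of a spread radicand `c·u·λ·v/n` in the logarithmic factor `u·v ≤ L`
(`c, λ ≥ 0`, `n > 0`). [folklore] -/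
private theorem twoHeavy_radicand_spread_le {c u lam v L n : ℝ} (hlam : 0 ≤ lam) (hn : 0 < n)
    (hc : 0 ≤ c) (h : u * v ≤ L) : c * u * lam * v / n ≤ c * lam * L / n := by
  rw [show c * u * lam * v = c * lam * (u * v) by ring]
  gcongr

/-- Monotonicity of a deficit radicand `c·w/n` in the logarithmic factor `w ≤ L` (`c ≥ 0`, `n > 0`),
written with the spread parameter `1`. [folklore] -/
private theorem twoHeavy_radicand_deficit_le {c w L n : ℝ} (hn : 0 < n) (hc : 0 ≤ c) (h : w ≤ L) :
    c * w / n ≤ c * 1 * L / n := by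
  rw [mul_one]
  gcongr

/-- One cyclic term: if `x ≤ 100aL/n`, `y ≤ 100bL/n`, `z ≤ 100cL/n` with `a, b, c ≥ 0`, `abc ≤ Λ`,
`L ≥ 0` and `n > 0`, then `√x·√y·√z ≤ 1000·√Λ·(L√L)/(n√n)` (compare the squares). [folklore] -/
private theorem twoHeavy_cycTerm_le {x y z a b c L Λ n : ℝ} (hn : 0 < n) (hL : 0 ≤ L) (ha : 0 ≤ a)
    (hb : 0 ≤ b) (hc : 0 ≤ c) (habc : a * b * c ≤ Λ) (hx : x ≤ 100 * a * L / n)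
    (hy : y ≤ 100 * b * L / n) (hz : z ≤ 100 * c * L / n) :
    Real.sqrt x * Real.sqrt y * Real.sqrt z ≤
      1000 * Real.sqrt Λ * (L * Real.sqrt L) / (n * Real.sqrt n) := by
  have hΛ : 0 ≤ Λ := le_trans (by positivity) habc
  have h1 : Real.sqrt x * Real.sqrt y * Real.sqrt z ≤
      Real.sqrt (100 * a * L / n) * Real.sqrt (100 * b * L / n) * Real.sqrt (100 * c * L / n) := by
    gcongr
  refine le_trans h1 (le_of_pow_le_pow_left₀ two_ne_zero (by positivity) ?_)
  have hX2 : (Real.sqrt (100 * a * L / n) * Real.sqrt (100 * b * L / n) *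
      Real.sqrt (100 * c * L / n)) ^ 2 = 10 ^ 6 * (a * b * c) * L ^ 3 / n ^ 3 := by
    rw [mul_pow, mul_pow, Real.sq_sqrt (by positivity), Real.sq_sqrt (by positivity),
      Real.sq_sqrt (by positivity)]
    ring
  have hY2 : (1000 * Real.sqrt Λ * (L * Real.sqrt L) / (n * Real.sqrt n)) ^ 2 =
      10 ^ 6 * Λ * L ^ 3 / n ^ 3 := by
    rw [div_pow, show (1000 * Real.sqrt Λ * (L * Real.sqrt L)) ^ 2 =
        10 ^ 6 * Real.sqrt Λ ^ 2 * L ^ 2 * Real.sqrt L ^ 2 by ring,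
      show (n * Real.sqrt n) ^ 2 = n ^ 2 * Real.sqrt n ^ 2 by ring,
      Real.sq_sqrt hΛ, Real.sq_sqrt hL, Real.sq_sqrt hn.le]
    ring
  rw [hX2, hY2]
  gcongr

set_option maxHeartbeats 1600000 in
/-- **Two heavy quotients.** For `n ≥ 40`, a parity-pure TPP triple `S, T, U ⊆ S_n` with
`N = |S||T||U|`, spread parameters `λ_A, λ_B, λ_C ≥ 1` of the three pair marginals
(`m_{ST}(i,j) ≤ λ_A|S||T|/n`, `m_{TU}(i,j) ≤ λ_B|T||U|/n`, `m_{US}(i,j) ≤ λ_C|U||S|/n`), a common bound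
`Λ` on `λ_Aλ_B, λ_Bλ_C, λ_Cλ_A` and a common bound `L ≥ 0` on the three logarithmic factors
`(1+log n)·log(4n·n!/(|S||T|))`, `(1+log n)·log(4n·n!/(|T||U|))`, `(1+log n)·log(4n·n!/(|U||S|))`:
`2N - n! - n!√(n!)/√(n(n-1)/6) ≤ 6000·(n-1)·N·√Λ·(L√L)/(n√n)`. This is `heavyQuotients` with each of
its three cyclic terms bounded by `1000·√Λ·(L√L)/(n√n)`. [folklore] -/
theorem twoHeavyQuotients (n : ℕ) (hn : 40 ≤ n) (S T U : Finset (Equiv.Perm (Fin n)))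
    (hTPP : TripleProductProperty S T U)
    (hS : ∀ s ∈ S, ∀ s' ∈ S, Equiv.Perm.sign s = Equiv.Perm.sign s')
    (hT : ∀ t ∈ T, ∀ t' ∈ T, Equiv.Perm.sign t = Equiv.Perm.sign t')
    (hU : ∀ u ∈ U, ∀ u' ∈ U, Equiv.Perm.sign u = Equiv.Perm.sign u')
    (lamA lamB lamC : ℝ) (hlamA : 1 ≤ lamA) (hlamB : 1 ≤ lamB) (hlamC : 1 ≤ lamC)
    (hA : ∀ i j : Fin n,
      (((S ×ˢ T).filter fun st => st.2 j = st.1 i).card : ℝ) ≤ lamA * (S.card * T.card : ℕ) / n)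
    (hB : ∀ i j : Fin n,
      (((T ×ˢ U).filter fun tu => tu.2 j = tu.1 i).card : ℝ) ≤ lamB * (T.card * U.card : ℕ) / n)
    (hC : ∀ i j : Fin n,
      (((U ×ˢ S).filter fun us => us.2 j = us.1 i).card : ℝ) ≤ lamC * (U.card * S.card : ℕ) / n)
    (Λ : ℝ) (hAB : lamA * lamB ≤ Λ) (hBC : lamB * lamC ≤ Λ) (hCA : lamC * lamA ≤ Λ)
    (L : ℝ) (hLA : (1 + Real.log n) * Real.log (4 * n * n.factorial / (S.card * T.card : ℕ)) ≤ L)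
    (hLB : (1 + Real.log n) * Real.log (4 * n * n.factorial / (T.card * U.card : ℕ)) ≤ L)
    (hLC : (1 + Real.log n) * Real.log (4 * n * n.factorial / (U.card * S.card : ℕ)) ≤ L)
    (hL : 0 ≤ L) :
    2 * ((S.card * T.card * U.card : ℕ) : ℝ) - (n.factorial : ℝ) -
        (n.factorial : ℝ) * Real.sqrt (n.factorial : ℝ) / Real.sqrt (((n * (n - 1) : ℕ) : ℝ) / 6) ≤
      6000 * ((n : ℝ) - 1) * ((S.card * T.card * U.card : ℕ) : ℝ) * Real.sqrt Λ * (L * Real.sqrt L) /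
        ((n : ℝ) * Real.sqrt n) := by
  have h := heavyQuotients n hn S T U hTPP hS hT hU lamA lamB lamC hlamA hlamB hlamC hA hB hC
  have h40 : (40 : ℝ) ≤ n := by exact_mod_cast hn
  have hnR : (0 : ℝ) < n := by linarith
  have hm : (0 : ℝ) < (n : ℝ) - 1 := by linarith
  have hlamA0 : 0 ≤ lamA := by linarith
  have hlamB0 : 0 ≤ lamB := by linarith
  have hlamC0 : 0 ≤ lamC := by linarith
  have h100 : (0 : ℝ) ≤ 100 := by norm_num
  refine le_trans h ?_
  calc _ ≤ 2 * ((n : ℝ) - 1) * ((S.card * T.card * U.card : ℕ) : ℝ) *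
        (1000 * Real.sqrt Λ * (L * Real.sqrt L) / ((n : ℝ) * Real.sqrt n) +
          1000 * Real.sqrt Λ * (L * Real.sqrt L) / ((n : ℝ) * Real.sqrt n) +
          1000 * Real.sqrt Λ * (L * Real.sqrt L) / ((n : ℝ) * Real.sqrt n)) := by
        gcongr
        · exact twoHeavy_cycTerm_le hnR hL hlamA0 hlamB0 zero_le_one (by linarith [hAB])
            (twoHeavy_radicand_spread_le hlamA0 hnR h100 hLA)
            (twoHeavy_radicand_spread_le hlamB0 hnR h100 hLB)
            (twoHeavy_radicand_deficit_le hnR h100 hLC)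
        · exact twoHeavy_cycTerm_le hnR hL hlamA0 zero_le_one hlamC0 (by linarith [hCA])
            (twoHeavy_radicand_spread_le hlamA0 hnR h100 hLA)
            (twoHeavy_radicand_deficit_le hnR h100 hLB)
            (twoHeavy_radicand_spread_le hlamC0 hnR h100 hLC)
        · exact twoHeavy_cycTerm_le hnR hL zero_le_one hlamB0 hlamC0 (by linarith [hBC])
            (twoHeavy_radicand_deficit_le hnR h100 hLA)
            (twoHeavy_radicand_spread_le hlamB0 hnR h100 hLB)
            (twoHeavy_radicand_spread_le hlamC0 hnR h100 hLC)
    _ = _ := by ring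

end Summit.MatrixMultiplication.MatrixMultiplication.Theorems.PolynomialSlack
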